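import Mathlib.Topology.Homotopy.Lifting
import Mathlib.GroupTheory.Index
import Mathlib.GroupTheory.GroupAction.Basic
import HarnessLib

/-!
# The monodromy action of `π₁(X, x)` on the fibre of a covering: stabilisers, transitivity, number of sheets (Hatcher, §1.3, Props. 1.31–1.32, 1.39)

Topic `Literature/Topology/CoveringSpaces`; campaign-L R1 (topological Galois correspondence for
covering maps), part (B) «connected covers». Everything is PROVED from Mathlib's covering-space
theory (`IsCoveringMap.monodromy`, `liftPathQuotient`, `map_liftPathQuotient`,
`monodromy_eq_of_map_eq`, `fundamentalGroupMulAction`); no definition, no named fact.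

Conventions (shared with the other R1 files): a covering is an unbundled `hp : IsCoveringMap p`,
`p : E → X`; the fibre over `x` is the subtype `p ⁻¹' {x}`; `π₁(X, x)` acts on it on the LEFT by
Mathlib's monodromy, `letI := hp.fundamentalGroupMulAction x` (so `γ • e = hp.monodromy γ e`, the
end point of the lift of `γ` starting at `e`); `p_* π₁(E, e)` is
`(FundamentalGroup.mapOfEq ⟨p, hp.continuous⟩ e.2).range ≤ π₁(X, x)`.

For a GENERAL covering map `p : E → X` (Mathlib has the corresponding statements only for
QUOTIENT coverings `E → E/G`, `IsQuotientCoveringMap.ker_monodromyPerm` etc.):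

* `mem_range_mapOfEq_iff_monodromy_eq`, `range_mapOfEq_eq_stabilizer` — **the stabiliser of a
  point `e` of the fibre is `p_* π₁(E, e)`** (Hatcher, Prop. 1.31: a loop lifts to a loop at `e`
  iff its class lies in `p_* π₁(E, e)`);
* `monodromy_eq_iff_exists_map_eq` — `γ • e = e'` iff `γ` is the image of a path class from `e`
  to `e'` in `E`;
* `exists_monodromy_eq` / `isPretransitive_monodromy` — **if `E` is path connected the action on
  each fibre is transitive**; conversely `pathConnectedSpace_of_forall_exists_monodromy_eq` — if
  `X` is path connected, `E` is nonempty and the action on ONE fibre is transitive then `E` is path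
  connected (so for path-connected `X` and nonempty `E`: transitive on a fibre ↔ `E` path
  connected, `pathConnectedSpace_iff_isPretransitive`);
* `index_range_mapOfEq_eq_natCard_fiber` — **the number of sheets of a covering with
  path-connected total space is the index of `p_* π₁(E, e)`** (Hatcher, Prop. 1.32), by
  orbit–stabiliser;
* `range_mapOfEq_monodromy_eq_map_conj`, `exists_range_mapOfEq_eq_map_conj` — **changing the base
  point within a fibre conjugates `p_* π₁`**: `p_* π₁(E, γ • e) = γ · p_* π₁(E, e) · γ⁻¹`; for
  path-connected `E` any two points of a fibre give conjugate subgroups (Hatcher, remark after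
  Prop. 1.37 / proof of Prop. 1.39).

## References

* A. Hatcher, *Algebraic Topology*, CUP 2002, §1.3: Prop. 1.31 (p. 61), Prop. 1.32 (p. 61),
  Prop. 1.39 (p. 71). [HatcherAT2002]
-/

noncomputable section

open Function

namespace Literature.Topology.CoveringSpaces

variable {E X : Type*} [TopologicalSpace E] [TopologicalSpace X] {p : E → X}

namespace CoverMonodromy

/-- **Stabilisers of the monodromy action** (Hatcher, Prop. 1.31): a class `γ ∈ π₁(X, x)` fixes
the point `e` of the fibre under the monodromy action iff `γ ∈ p_* π₁(E, e)`.
[cite: HatcherAT2002, Prop. 1.31] -/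
theorem mem_range_mapOfEq_iff_monodromy_eq (hp : IsCoveringMap p) {x : X} (e : p ⁻¹' {x})
    (γ : FundamentalGroup X x) :
    γ ∈ (FundamentalGroup.mapOfEq ⟨p, hp.continuous⟩ e.2).range ↔ hp.monodromy γ e = e := by
  constructor
  · rintro ⟨δ, rfl⟩
    exact hp.monodromy_eq_of_map_eq δ (by simp [FundamentalGroup.mapOfEq_apply])
  · intro h
    refine ⟨(hp.liftPathQuotient γ e).cast rfl congr($h.symm), ?_⟩
    rw [FundamentalGroup.mapOfEq_apply, Path.Homotopic.Quotient.map_cast,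
      IsCoveringMap.map_liftPathQuotient]
    simp

/-- The stabiliser of `e ∈ p⁻¹(x)` in `π₁(X, x)` (monodromy action) is `p_* π₁(E, e)`.
[cite: HatcherAT2002, Prop. 1.31] -/
theorem range_mapOfEq_eq_stabilizer (hp : IsCoveringMap p) {x : X} (e : p ⁻¹' {x}) :
    letI := hp.fundamentalGroupMulAction x
    (FundamentalGroup.mapOfEq ⟨p, hp.continuous⟩ e.2).range =
      MulAction.stabilizer (FundamentalGroup X x) e := by
  ext γ
  exact mem_range_mapOfEq_iff_monodromy_eq hp e γ

/-- `γ • e = e'` for the monodromy action iff `γ` is the image under `p` of a path class from `e`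
to `e'` in the total space. [cite: HatcherAT2002, Prop. 1.31] -/
theorem monodromy_eq_iff_exists_map_eq (hp : IsCoveringMap p) {x : X} (e e' : p ⁻¹' {x})
    (γ : FundamentalGroup X x) :
    hp.monodromy γ e = e' ↔
      ∃ Γ : Path.Homotopic.Quotient (e : E) (e' : E),
        Γ.map ⟨p, hp.continuous⟩ = (FundamentalGroup.toPath γ).cast e.2 e'.2 := by
  constructor
  · rintro rfl
    exact ⟨hp.liftPathQuotient γ e, hp.map_liftPathQuotient γ e⟩
  · rintro ⟨Γ, hΓ⟩
    exact hp.monodromy_eq_of_map_eq Γ hΓ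

/-- A path in the total space from `e` to `e'` (two points of one fibre) projects to a loop whose
monodromy carries `e` to `e'`. [cite: HatcherAT2002, Prop. 1.31] -/
theorem monodromy_mk_map_cast (hp : IsCoveringMap p) {x : X} (e e' : p ⁻¹' {x})
    (Γ : Path (e : E) (e' : E)) :
    hp.monodromy (Path.Homotopic.Quotient.mk ((Γ.map hp.continuous).cast e.2.symm e'.2.symm)) e =
      e' :=
  hp.monodromy_eq_of_map_eq (γ := Path.Homotopic.Quotient.mk _) (Γ := Path.Homotopic.Quotient.mk Γ)
    (by
      rw [← Path.Homotopic.Quotient.mk_map, ← Path.Homotopic.Quotient.mk_cast]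
      congr 1)

/-- **Transitivity** (Hatcher, proof of Prop. 1.32): if the total space is path connected, the
monodromy action of `π₁(X, x)` on the fibre `p⁻¹(x)` is transitive. [cite: HatcherAT2002, Prop. 1.32] -/
theorem exists_monodromy_eq [PathConnectedSpace E] (hp : IsCoveringMap p) {x : X}
    (e e' : p ⁻¹' {x}) : ∃ γ : FundamentalGroup X x, hp.monodromy γ e = e' :=
  ⟨_, monodromy_mk_map_cast hp e e' (PathConnectedSpace.somePath (e : E) (e' : E))⟩

/-- Transitivity, `MulAction.IsPretransitive` form. [cite: HatcherAT2002, Prop. 1.32] -/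
theorem isPretransitive_monodromy [PathConnectedSpace E] (hp : IsCoveringMap p) (x : X) :
    letI := hp.fundamentalGroupMulAction x
    MulAction.IsPretransitive (FundamentalGroup X x) (p ⁻¹' {x}) :=
  letI := hp.fundamentalGroupMulAction x
  ⟨fun e e' => exists_monodromy_eq hp e e'⟩

/-- Converse: if `X` is path connected, `E` is nonempty and `π₁(X, x)` acts transitively on the
fibre over ONE point `x`, then `E` is path connected (every point of `E` is joined to the fibre
over `x` by a lifted path, and the points of that fibre are joined by lifted loops).
[cite: HatcherAT2002, Prop. 1.32] -/
theorem pathConnectedSpace_of_forall_exists_monodromy_eq [PathConnectedSpace X] [Nonempty E]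
    (hp : IsCoveringMap p) (x : X)
    (h : ∀ e e' : p ⁻¹' {x}, ∃ γ : FundamentalGroup X x, hp.monodromy γ e = e') :
    PathConnectedSpace E := by
  -- every point of `E` is joined to some point of the fibre over `x`
  have key : ∀ z : E, ∃ e : p ⁻¹' {x}, Joined z (e : E) := by
    intro z
    let δ : Path (p z) x := PathConnectedSpace.somePath (p z) x
    refine ⟨hp.monodromy (Path.Homotopic.Quotient.mk δ) ⟨z, rfl⟩, ?_⟩
    obtain ⟨Γ⟩ := Quotient.exists_rep (hp.liftPathQuotient (Path.Homotopic.Quotient.mk δ) ⟨z, rfl⟩)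
    exact ⟨Γ⟩
  -- two points of the fibre are joined
  have fib : ∀ e e' : p ⁻¹' {x}, Joined (e : E) (e' : E) := by
    intro e e'
    obtain ⟨γ, hγ⟩ := h e e'
    obtain ⟨Γ⟩ := Quotient.exists_rep (hp.liftPathQuotient γ e)
    rw [hγ] at Γ
    exact ⟨Γ⟩
  refine ⟨‹Nonempty E›, fun z w => ?_⟩
  obtain ⟨e, he⟩ := key z
  obtain ⟨e', he'⟩ := key w
  exact (he.trans (fib e e')).trans he'.symm

/-- For a path-connected base and a nonempty total space: the monodromy action on the fibre over
`x` is transitive iff the total space is path connected. [cite: HatcherAT2002, Prop. 1.32] -/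
theorem pathConnectedSpace_iff_isPretransitive [PathConnectedSpace X] [Nonempty E]
    (hp : IsCoveringMap p) (x : X) :
    letI := hp.fundamentalGroupMulAction x
    PathConnectedSpace E ↔ MulAction.IsPretransitive (FundamentalGroup X x) (p ⁻¹' {x}) := by
  letI := hp.fundamentalGroupMulAction x
  refine ⟨fun _ => isPretransitive_monodromy hp x, fun hT => ?_⟩
  exact pathConnectedSpace_of_forall_exists_monodromy_eq hp x fun e e' => hT.exists_smul_eq e e'

/-- **Number of sheets = index of `p_* π₁`** (Hatcher, Prop. 1.32): for a covering with
path-connected total space, `[π₁(X, x) : p_* π₁(E, e)] = #p⁻¹(x)` (as `Nat.card`, so `0` on both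
sides for an infinite fibre). [cite: HatcherAT2002, Prop. 1.32] -/
theorem index_range_mapOfEq_eq_natCard_fiber [PathConnectedSpace E] (hp : IsCoveringMap p)
    {x : X} (e : p ⁻¹' {x}) :
    (FundamentalGroup.mapOfEq ⟨p, hp.continuous⟩ e.2).range.index = Nat.card (p ⁻¹' {x}) := by
  letI := hp.fundamentalGroupMulAction x
  haveI := isPretransitive_monodromy hp x
  rw [range_mapOfEq_eq_stabilizer hp e]
  exact MulAction.index_stabilizer_of_transitive (FundamentalGroup X x) e

/-- **Change of base point within a fibre conjugates `p_* π₁`**: for `γ ∈ π₁(X, x)` and `e` over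
`x`, `p_* π₁(E, γ • e) = γ · p_* π₁(E, e) · γ⁻¹` (Hatcher, proof of Prop. 1.39: the stabiliser of
`γ • e` is the conjugate of the stabiliser of `e`). [cite: HatcherAT2002, Prop. 1.39] -/
theorem range_mapOfEq_monodromy_eq_map_conj (hp : IsCoveringMap p) {x : X} (e : p ⁻¹' {x})
    (γ : FundamentalGroup X x) :
    (FundamentalGroup.mapOfEq ⟨p, hp.continuous⟩ (hp.monodromy γ e).2).range =
      (FundamentalGroup.mapOfEq ⟨p, hp.continuous⟩ e.2).range.map (MulAut.conj γ).toMonoidHom := by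
  letI := hp.fundamentalGroupMulAction x
  rw [range_mapOfEq_eq_stabilizer hp, range_mapOfEq_eq_stabilizer hp e]
  exact MulAction.stabilizer_smul_eq_stabilizer_map_conj γ e

/-- For a covering with path-connected total space, the subgroups `p_* π₁(E, e)`, `p_* π₁(E, e')`
at two points of one fibre are conjugate in `π₁(X, x)`. [cite: HatcherAT2002, Prop. 1.39] -/
theorem exists_range_mapOfEq_eq_map_conj [PathConnectedSpace E] (hp : IsCoveringMap p) {x : X}
    (e e' : p ⁻¹' {x}) :
    ∃ γ : FundamentalGroup X x,
      (FundamentalGroup.mapOfEq ⟨p, hp.continuous⟩ e'.2).range =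
        (FundamentalGroup.mapOfEq ⟨p, hp.continuous⟩ e.2).range.map (MulAut.conj γ).toMonoidHom := by
  obtain ⟨γ, rfl⟩ := exists_monodromy_eq hp e e'
  exact ⟨γ, range_mapOfEq_monodromy_eq_map_conj hp e γ⟩

/-- `p_* π₁(E, e)` is normal iff it is the stabiliser of EVERY point of the fibre, when the total
space is path connected (Hatcher, Prop. 1.39: a covering is normal iff `p_* π₁` is normal; here
the purely group-theoretic half). [cite: HatcherAT2002, Prop. 1.39] -/
theorem normal_range_mapOfEq_iff_forall [PathConnectedSpace E] (hp : IsCoveringMap p) {x : X}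
    (e : p ⁻¹' {x}) :
    (FundamentalGroup.mapOfEq ⟨p, hp.continuous⟩ e.2).range.Normal ↔
      ∀ e' : p ⁻¹' {x}, (FundamentalGroup.mapOfEq ⟨p, hp.continuous⟩ e'.2).range =
        (FundamentalGroup.mapOfEq ⟨p, hp.continuous⟩ e.2).range := by
  constructor
  · intro hN e'
    obtain ⟨γ, hγ⟩ := exists_range_mapOfEq_eq_map_conj hp e e'
    haveI := hN
    rw [hγ, MulEquiv.toMonoidHom_eq_coe, Subgroup.Normal.map_conj_eq]
  · intro h
    refine Subgroup.normal_iff_map_conj_eq.mpr fun γ => ?_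
    rw [← MulEquiv.toMonoidHom_eq_coe, ← range_mapOfEq_monodromy_eq_map_conj hp e γ]
    exact h _

end CoverMonodromy

end Literature.Topology.CoveringSpaces
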